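import Summits.AtomisticToContinuum.FouriersLaw.Theses.ContactStieltjesMeasure

/-!
# IdeasK4g3Sketch — crux idea `boundary-energy-class` (crux-ideate r2, ideator 4 / g3, stmt-AtomisticToContinuum-15248)

First checkable statements of the BOUNDARY-ENERGY-CLASS lever for the `φ⁴` edge `stub_phi4Edge`
(`β = 0 < lam`; crux ⇔ edge by `CayleyPencil.stieltjesRepresentation_iff_phi4Edge`, p167063).
The class is `{k smooth : ∂_{p_0} k, ∂_{p_{N-1}} k ∈ L²(μ_T)}` — finite Dirichlet energy in the two
bath momenta w.r.t. the explicit equilibrium Gibbs measure; no spectral gap, no Lyapunov function,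
no polynomial corrector bounds, no moments of the steady states.  Definitions only (Props); the one
`example` checks that the edge clause below is the tree's, verbatim.
-/

noncomputable section

open MeasureTheory Filter Set
open scoped Topology ContDiff
open Literature.MathematicalPhysics.KineticTheory.HeatConduction

namespace Summit.AtomisticToContinuum.FouriersLaw.Cruxes.StieltjesRepresentation.IdeasK4g3

/-- **FIRST LEMMA — energy-class Liouville theorem at equilibrium** (closed range `0 ≤ lam`, `0 ≤ β`,
every `N`).  A `C²` solution of `L_{T,T} w = 0` whose two bath-momentum derivatives are square
integrable against the Gibbs measure `μ_T` is constant.  Mechanism: under the stationary diffusion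
started from `μ_T`, `M_t = w(X_t) - w(X_0)` is a martingale with `E⟨M⟩_t = 2γT·t·‖∇_{p_∂} w‖²_{L²(μ_T)}`
and is tight (difference of two identically distributed variables); Dambis–Dubins–Schwarz + Birkhoff
(ergodic components) force `‖∇_{p_∂} w‖ = 0`; then `X_H w = 0` and the brackets
`[∂_{p_i}, X_H] = ∂_{q_i}`, `[∂_{q_i}, X_H] ∋ V''(r_i) ∂_{p_{i+1}}` (`V'' = 1 + 3βr² ≥ 1`) propagate
`∂ w = 0` through the chain.  No growth condition on `w` itself. -/
def BoundaryEnergyLiouville : Prop :=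
  ∀ ω₂ lam β γ T : ℝ, 0 < ω₂ → 0 ≤ lam → 0 ≤ β → 0 < γ → 0 < T →
    ∀ (N : ℕ) (i₀ i₁ : Fin N), i₀.val = 0 → i₁.val = N - 1 →
    ∀ w : PhaseSpace N → ℝ, ContDiff ℝ 2 w →
      (∀ x, (pinnedChain ω₂ lam β γ).generator N T T w x = 0) →
      Integrable (fun x : PhaseSpace N => partialP i₀ w x ^ 2 + partialP i₁ w x ^ 2)
        ((pinnedChain ω₂ lam β γ).gibbsMeasure N T) →
      ∃ c : ℝ, ∀ x, w x = c

/-- Corollary shape used by the line (immediate from `BoundaryEnergyLiouville` by linearity):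
energy-class solutions of the equilibrium Poisson equation with the contact source `p_0² - T` are
unique up to an additive constant — on the `φ⁴` edge, with NO bound on the solution itself. -/
def EnergyClassUnique : Prop :=
  ∀ ω₂ lam γ T : ℝ, 0 < ω₂ → 0 < lam → 0 < γ → 0 < T →
    ∀ (N : ℕ) (i₀ i₁ : Fin N), i₀.val = 0 → i₁.val = N - 1 →
    ∀ k k' : PhaseSpace N → ℝ, ContDiff ℝ 2 k → ContDiff ℝ 2 k' →
      (∀ x, (pinnedChain ω₂ lam 0 γ).generator N T T k x = -((x.2 i₀) ^ 2 - T)) →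
      (∀ x, (pinnedChain ω₂ lam 0 γ).generator N T T k' x = -((x.2 i₀) ^ 2 - T)) →
      Integrable (fun x : PhaseSpace N => partialP i₀ k x ^ 2 + partialP i₁ k x ^ 2)
        ((pinnedChain ω₂ lam 0 γ).gibbsMeasure N T) →
      Integrable (fun x : PhaseSpace N => partialP i₀ k' x ^ 2 + partialP i₁ k' x ^ 2)
        ((pinnedChain ω₂ lam 0 γ).gibbsMeasure N T) →
      ∃ c : ℝ, ∀ x, k' x = k x + c

/-- Tightness at `δ = 0` of a `δ`-indexed family of measures, measured by energy sublevel sets. -/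
def TightAt (N : ℕ) (H : PhaseSpace N → ℝ) (ν : ℝ → Measure (PhaseSpace N)) : Prop :=
  ∀ ε : ℝ, 0 < ε → ∃ E δ₀ : ℝ, 0 < δ₀ ∧ ∀ δ : ℝ, |δ| < δ₀ → ν δ {x | E < H x} ≤ ENNReal.ofReal ε

/-- **C⁺ — EQUILIBRIUM TIGHTNESS on the `φ⁴` edge** (the single residual of the line): along every
family of weak steady states of `pinnedChain ω₂ lam 0 γ` (`0 < lam`, length `N ≥ 2`), the states at
bath temperatures `(T + δ/2, T - δ/2)` are tight as `δ → 0`.  Zeroth order: no rate, no moment,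
no derivative bound; implied by ANY `δ`-uniform coercive Lyapunov bound (cards
`breather-graded-lyapunov`, `equilibrium-corrector-lyapunov`), but much weaker than either. -/
def EquilibriumTightness : Prop :=
  ∀ ω₂ lam γ T : ℝ, 0 < ω₂ → 0 < lam → 0 < γ → 0 < T → ∀ N : ℕ, 2 ≤ N →
    ∀ μ : ℝ → ℝ → Measure (PhaseSpace N),
      (∀ T_L T_R : ℝ, 0 < T_L → 0 < T_R →
        (pinnedChain ω₂ lam 0 γ).IsSteadyState N T_L T_R (μ T_L T_R)) →
      TightAt N ((pinnedChain ω₂ lam 0 γ).hamiltonian N) (fun δ => μ (T + δ / 2) (T - δ / 2))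

/-- **ENERGY-CLASS RESPONSE (the line's conditional theorem on the `φ⁴` edge).**  Given ONE `C²`
energy-class solution `k` of the equilibrium Poisson equation `L_{T,T} k = -(p_0² - T)` and tightness of
the steady family at `(T,T)`, the crux's difference quotient converges, to
`(N-1)·γ·(1/2 - (γ/2T)·μ_T(p_0 ∂_{p_0}k - p_{N-1} ∂_{p_{N-1}}k))` — a pairing of two `L²(μ_T)`-bounded
boundary gradients (`(p_0, -p_{N-1}) = ∇_{p_∂} U*`, `U* = (p_0² - p²_{N-1})/2`, and `∇_{p_∂} k`).
Proof skeleton: contact Fisher bound `O(δ²)` (entropy balance; `IdeasK5.ContactFisherBound`) =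
Dirichlet bound on the half-density `√(dμ_δ/dμ_T)`; Hellinger linearisation (fibrewise Gaussian
calculus); tightness ⇒ Hellinger continuity (uniform local hypoelliptic bounds); identification of
every subsequential limit of `∇_{p_∂}(√h_δ - c_δ)/δ` as `∇_{p_∂}` of an energy-class solution (local
hypoelliptic Poincaré lemma) — unique by `BoundaryEnergyLiouville`.  No uniqueness-of-NESS input. -/
def EnergyClassResponse : Prop :=
  ∀ ω₂ lam γ T : ℝ, 0 < ω₂ → 0 < lam → 0 < γ → 0 < T →
    ∀ (N : ℕ) (i₀ i₁ : Fin N), 2 ≤ N → i₀.val = 0 → i₁.val = N - 1 →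
    ∀ k : PhaseSpace N → ℝ, ContDiff ℝ 2 k →
      (∀ x, (pinnedChain ω₂ lam 0 γ).generator N T T k x = -((x.2 i₀) ^ 2 - T)) →
      Integrable (fun x : PhaseSpace N => partialP i₀ k x ^ 2 + partialP i₁ k x ^ 2)
        ((pinnedChain ω₂ lam 0 γ).gibbsMeasure N T) →
      ∀ μ : ℝ → ℝ → Measure (PhaseSpace N),
        (∀ T_L T_R : ℝ, 0 < T_L → 0 < T_R →
          (pinnedChain ω₂ lam 0 γ).IsSteadyState N T_L T_R (μ T_L T_R)) →
        TightAt N ((pinnedChain ω₂ lam 0 γ).hamiltonian N) (fun δ => μ (T + δ / 2) (T - δ / 2)) →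
        Tendsto (fun δ : ℝ => (pinnedChain ω₂ lam 0 γ).totalCurrent (μ (T + δ / 2) (T - δ / 2)) / δ)
          (𝓝[≠] 0)
          (𝓝 (((N : ℝ) - 1) * γ * (1 / 2 - γ / (2 * T) *
            ∫ x, (x.2 i₀ * partialP i₀ k x - x.2 i₁ * partialP i₁ k x)
              ∂((pinnedChain ω₂ lam 0 γ).gibbsMeasure N T))))

/-- **ENERGY-CLASS CORRECTOR ON THE EDGE (existence, every `N ≥ 2`)** — obtained in the line as the
`β ↓ 0` limit of the tree's `β > 0` correctors (uniform Dirichlet bound `‖∇_{p_∂}k_β‖ ≤ ‖g‖/γ` from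
the energy identity, local hypoelliptic compactness, `BoundaryEnergyLiouville` for the limit), or
equivalently from the steady family itself (`(√h_δ - c_δ)/δ`).  Smooth by hypoellipticity. -/
def EnergyClassCorrector : Prop :=
  ∀ ω₂ lam γ T : ℝ, 0 < ω₂ → 0 < lam → 0 < γ → 0 < T →
    ∀ (N : ℕ) (i₀ i₁ : Fin N), 2 ≤ N → i₀.val = 0 → i₁.val = N - 1 →
    ∃ k : PhaseSpace N → ℝ, ContDiff ℝ 2 k ∧
      (∀ x, (pinnedChain ω₂ lam 0 γ).generator N T T k x = -((x.2 i₀) ^ 2 - T)) ∧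
      Integrable (fun x : PhaseSpace N => partialP i₀ k x ^ 2 + partialP i₁ k x ^ 2)
        ((pinnedChain ω₂ lam 0 γ).gibbsMeasure N T)

/-- The `φ⁴`-edge clause of the crux (`β = 0 < lam`), verbatim the right-hand side of
`CayleyPencil.stieltjesRepresentation_iff_phi4Edge` (= registered stub `stub_phi4Edge`). -/
def Phi4Edge : Prop :=
  ∀ ω₂ lam : ℝ, 0 < ω₂ → 0 < lam → ∀ T : ℝ, 0 < T →
    ∃ Φ : ℕ → ℝ → ℝ, ∀ N : ℕ, 2 ≤ N → Monotone (Φ N) ∧ (∀ s : ℝ, s ≤ 0 → Φ N s = 0) ∧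
      (∃ m : ℝ, ∀ s : ℝ, Φ N s ≤ m) ∧ ∀ γ : ℝ, 0 < γ →
        (∀ (N' : ℕ) (T_L T_R : ℝ), 0 < T_L → 0 < T_R → ∀ μ ν : Measure (PhaseSpace N'),
          (pinnedChain ω₂ lam 0 γ).IsSteadyState N' T_L T_R μ →
          (pinnedChain ω₂ lam 0 γ).IsSteadyState N' T_L T_R ν → μ = ν) →
        ∀ μ : (N' : ℕ) → ℝ → ℝ → Measure (PhaseSpace N'),
          (∀ (N' : ℕ) (T_L T_R : ℝ), 0 < T_L → 0 < T_R →
            (pinnedChain ω₂ lam 0 γ).IsSteadyState N' T_L T_R (μ N' T_L T_R)) →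
          Tendsto (fun δ : ℝ => (pinnedChain ω₂ lam 0 γ).totalCurrent (μ N (T + δ / 2) (T - δ / 2)) / δ)
            (𝓝[≠] 0)
            (𝓝 (((N : ℝ) - 1) * γ * ∫ t in Set.Ioi (0 : ℝ), Φ N t * (2 * t / (γ ^ 2 + t ^ 2) ^ 2)))

/- Kernel fact p167063 (not imported here to keep the import closure light):
`Summit.AtomisticToContinuum.FouriersLaw.Theorems.ContactStieltjesMeasure.CayleyPencil.stieltjesRepresentation_iff_phi4Edge :
  StieltjesRepresentation ↔ Phi4Edge` (module `…Theorems.ContactStieltjesMeasureStieltjesRepresentationNarrowed`;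
`Phi4Edge` above is its right-hand side verbatim). -/

/-- Sanity: the crux decl is in scope by name (the line's composition target). -/
example : Prop := Summit.AtomisticToContinuum.FouriersLaw.Theses.ContactStieltjesMeasure.StieltjesRepresentation

/-- **STIELTJES ON THE EDGE BY `β ↓ 0` (the identification step).**  The energy-class response value is
the pointwise-in-`γ` limit of the tree's `β > 0` contact pencils (landed `stub_stieltjesRepresentation_pos`),
each `γ·Stieltjes(γ²)` with `β`-uniform mass `μ_{T,β}(U''(q_0) + V''(r_0))`; Helly closedness makes the limit
a `γ`-free `Φ_N`.  Typed as: corrector existence + energy-class response + tightness ⇒ the edge clause. -/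
def EdgeByContinuity : Prop :=
  EnergyClassCorrector → EnergyClassResponse → EquilibriumTightness → Phi4Edge

/-- **TRANSFER (C⁺ ⇒ crux).**  With the line's equilibrium lemmas in hand, the crux reduces to tightness. -/
def TightnessTransfer : Prop := EquilibriumTightness → Phi4Edge

theorem tightnessTransfer_of (h₁ : EnergyClassCorrector) (h₂ : EnergyClassResponse) (h₃ : EdgeByContinuity) :
    TightnessTransfer := fun hT => h₃ h₁ h₂ hT

theorem phi4Edge_of (h : TightnessTransfer) (hT : EquilibriumTightness) : Phi4Edge := h hT

end Summit.AtomisticToContinuum.FouriersLaw.Cruxes.StieltjesRepresentation.IdeasK4g3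

end
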